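import Literature.Probability.Percolation.OneArmPivotalLayer
import Literature.Probability.Percolation.NearCriticalBoundaryFacts
import Literature.Probability.Percolation.NearCriticalFourArmFactsSymm
import HarnessLib

/-!
# Pivotal sites of the one-arm event near `∂Λ_N`: the mixed half-plane pair, for the sub-critical side (proofs only)

Topic `Literature/Probability/Percolation`; family `crit-perc`, statement **crit-perc.S16**
(`Literature.Probability.Percolation.triTheta_exponent`). Proofs only (no new definition, no new
named fact). Sibling of `OneArmBoundaryArms.lean` / `OneArmPivotalLayer.lean` (W. Werner, PCMI
2009, Lecture 6, proof of Lemma 6.2, "the contributions due to those `x`'s that are close to the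
edges … do not matter much … we shall use a priori estimates of probabilities of three arms in a
half-plane", adapted to the one-arm event, §5; P. Nolin, *Electron. J. Probab.* 13 (2008), §4.6,
§6.2). There a pivotal site `v` of `{0 ↔ ∂Λ_N}` at depth `d' = N - |v|_𝕋` is shown to force, besides
the inner arm and the local four arms, **two closed arms** in the half-plane beyond `v`, whose
probability for `t ≥ 1/2` is at most its critical value (a decreasing event), `≤ cst · d'/N` by the
universal half-plane two-arm bound `Nolin2008_halfPlane_twoArm`. On the SUB-CRITICAL side `t < 1/2`
the closed colour is super-critical and this monotonicity is lost; instead one uses the **mixed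
pair** — the open arm of the pivotal path towards the origin and one of the two closed arms, both
inside `Λ_N`, hence inside the half-plane — whose probability is controlled uniformly below `L(t)`
by Werner's near-critical half-plane two-arm bound `Werner2009_halfPlane_twoArm`
(`NearCriticalBoundaryFacts.lean`: `P_t(B_{T,F}(m, n)) ≤ C m/n`, `t ∈ [1/2, 1/2 + δ)`, `n ≤ L(t, ε)`),
transferred to `t < 1/2` by colour exchange (`Werner2009_halfPlane_twoArm.two_sided`: `ω ↦ ωᶜ` maps
`P_t` to `P_{1-t}` and `B_{T,F}` to `B_{F,T} = B_{T,F}`, the tree's `domArmEvent` imposing no order on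
the arms).

## Contents (all proved)

* `compl_preimage_domArmEvent`, `domArmEvent_comp_equiv`, `real_domArmEvent_symm`,
  `real_domArmEvent_mixed_symm`, `Werner2009_halfPlane_twoArm.two_sided` — colour exchange for
  confined arm events;
* `shift_mem_domArmEvent_mixed` — **the mixed pair**: if `v` is pivotal for `{0 ↔ ∂Λ_N}`,
  `|v|_𝕋 ≤ N`, `2D ≤ |v|_𝕋`, `1 ≤ d₂`, `d₂ + 1 ≤ D`, then `ω - v` has an open and a closed arm from
  `∂Λ_{d₂}` to `∂Λ_D` inside the domain `{w | |w + v|_𝕋 ≤ N}` (`domArmEvent ![T,F] d₂ D`): the closed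
  arm is one of the two of `shift_mem_domArmEvent_two_closed` (`OneArmBoundaryArms.lean`), the open
  one is the segment across the annulus of the open path of `ω ∪ {v}` from a neighbour of `v` to the
  origin (inside `Λ_N`, avoiding `v`); open and closed sites being distinct, the two arms are disjoint;
* `boundary_pivotal_three_le_mixed`, `boundary_pivotal_two_le_mixed` — the product bounds of
  `OneArmPivotalLayer.lean` with the mixed pair `B_{T,F}` in place of `B_{F,F}`:
  `P_t(v pivotal) ≤ P_t(0 ↔ ∂Λ_{m₀}) · π̂_t(r₀, d') · P_t(B_{T,F}(d₂ + d', D - d'))` and the same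
  without the local factor (three events on disjoint site sets; translation and rotation
  invariance of `P_t`).

## References

* W. Werner, *Lectures on two-dimensional critical percolation*, IAS/Park City Math. Ser. 16
  (2009), Lecture 6, §3 ¶1, proof of Lemma 6.2 (boundary contributions), §5 [WernerPCMI2009].
* P. Nolin, Near-critical percolation in two dimensions, *Electron. J. Probab.* 13 (2008), §4.6
  (arms in the half-plane), §6.2 (proof of Thm. 27, Case 1) [arXiv 0711.4948] [Nolin2008].
* H. Kesten, Scaling relations for 2D-percolation, *Comm. Math. Phys.* 109 (1987), Lemma 8
  [KestenScalingCMP1987].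

Tree: `shift_mem_domArmEvent_two_closed`, `shift_mem_armEvent_of_isPivotal_triOneArm'`,
`exists_rot_halfPlane_superset`, `shift_mem_domArmEvent_recenter`, `real_domArmEvent_rotPow`
(`OneArmBoundaryArms.lean`), `isPivotal_triOneArm_subset_triOneArm`, `relabel_shift_shift`,
`determinedBy_preimage_shift` (`OneArmPivotalLayer.lean`), `mem_domArmEvent_of_pathIn`,
`determinedBy_domArmEvent`, `domArmEvent` (`HalfPlaneArmEvents.lean`), `PathIn.split_at`,
`isPivotal_iff_insert_mem_and_notMem`, `inter_insert_diff_subset` (`ParaPivotalArms.lean`),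
`PathIn.exit`, `PathIn.last_exit` (`SitePaths.lean`), `pathIn_map_iso` (`TriRSWChaining.lean`),
`isColouredPath_compl_iff` (`ArmEventsStructure.lean`), `sitePercolation_real_preimage_compl`
(`TriHexLemma.lean`), `sitePercolation_real_inter_of_disjoint`, `sitePercolation_real_preimage_relabel`
(`SitePercolationMeasure.lean`), `Werner2009_halfPlane_twoArm` (`NearCriticalBoundaryFacts.lean`).
-/

noncomputable section

open MeasureTheory Set
open scoped unitInterval

namespace Literature.Probability.Percolation

open LatticeModels

/-! ### Colour exchange for confined arm events -/

/-- Complementing the configuration flips all the colours of a confined arm event: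
`compl ⁻¹' domArmEvent κ r R H = domArmEvent (¬κ) r R H`. [cite: SmirnovWernerMRL2001, Rem. 2] -/
theorem compl_preimage_domArmEvent {k : ℕ} (κ : Fin k → Bool) (r R : ℕ) (H : Set (Site 2)) :
    compl ⁻¹' domArmEvent κ r R H = domArmEvent (fun j => !κ j) r R H := by
  ext ω
  simp only [Set.mem_preimage, domArmEvent, Set.mem_setOf_eq, isColouredPath_compl_iff]

/-- Relabelling the arms of a confined arm event along a bijection of the index set:
`domArmEvent (κ ∘ e) r R H ⊆ domArmEvent κ r R H`. [folklore] -/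
theorem domArmEvent_comp_equiv_subset {k : ℕ} (κ : Fin k → Bool) (e : Fin k ≃ Fin k) (r R : ℕ)
    (H : Set (Site 2)) : domArmEvent (κ ∘ e) r R H ⊆ domArmEvent κ r R H := by
  rintro ω ⟨x, y, w, hw, hdisj⟩
  refine ⟨fun j => x (e.symm j), fun j => y (e.symm j), fun j => w (e.symm j), fun j => ?_, ?_⟩
  · obtain ⟨h1, h2, h3, h4, h5⟩ := hw (e.symm j)
    refine ⟨h1, h2, h3, h4, ?_⟩
    simpa only [Function.comp_apply, Equiv.apply_symm_apply] using h5
  · intro i j hij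
    exact hdisj (fun h => hij (e.symm.injective h))

/-- **Confined arm events are invariant under relabelling of the arms** (no order of the arms is
imposed by `domArmEvent`). [folklore] -/
theorem domArmEvent_comp_equiv {k : ℕ} (κ : Fin k → Bool) (e : Fin k ≃ Fin k) (r R : ℕ)
    (H : Set (Site 2)) : domArmEvent (κ ∘ e) r R H = domArmEvent κ r R H := by
  refine Subset.antisymm (domArmEvent_comp_equiv_subset κ e r R H) ?_
  have h := domArmEvent_comp_equiv_subset (κ ∘ e) e.symm r R H
  have hκ : (κ ∘ e) ∘ e.symm = κ := by
    funext j; simp only [Function.comp_apply, Equiv.apply_symm_apply]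
  rwa [hκ] at h

/-- **Colour exchange**: `P_{1-t}(domArmEvent κ r R H) = P_t(domArmEvent (¬κ) r R H)`. [cite: SmirnovWernerMRL2001, Rem. 2] -/
theorem real_domArmEvent_symm {k : ℕ} (t : unitInterval) (κ : Fin k → Bool) (r R : ℕ)
    (H : Set (Site 2)) :
    (triSitePercolation (σ t)).real (domArmEvent κ r R H) =
      (triSitePercolation t).real (domArmEvent (fun j => !κ j) r R H) := by
  rw [← compl_preimage_domArmEvent, triSitePercolation, triSitePercolation,
    sitePercolation_real_preimage_compl]

/-- The flipped mixed pattern is the mixed pattern with the two arms swapped. [folklore] -/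
theorem not_mixed_eq_comp_swap :
    (fun j => !(![true, false] : Fin 2 → Bool) j) =
      (![true, false] : Fin 2 → Bool) ∘ Equiv.swap (0 : Fin 2) 1 := by
  funext j
  fin_cases j <;> rfl

/-- **The mixed half-plane pair has the same probability at `t` and `1 - t`**:
`P_{1-t}(B_{T,F}(r, R; H)) = P_t(B_{T,F}(r, R; H))` (colour exchange swaps the two arms). [cite: Nolin2008, §2.1 (P̂ between P_p and P_{1-p}) and §4.6] -/
theorem real_domArmEvent_mixed_symm (t : unitInterval) (r R : ℕ) (H : Set (Site 2)) :
    (triSitePercolation (σ t)).real (domArmEvent ![true, false] r R H) =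
      (triSitePercolation t).real (domArmEvent ![true, false] r R H) := by
  rw [real_domArmEvent_symm, not_mixed_eq_comp_swap, domArmEvent_comp_equiv]

/-- **The near-critical half-plane two-arm bound on both sides of `1/2`** (Werner 2009, Lecture 6,
§3 ¶1, "uniform estimates for … two-arms in the half-plane" below `L(p)`; Nolin 2008, Thm. 24 (i)
with Thm. 27 and §4.6, uniformly in `P̂` between `P_p` and `P_{1-p}`): the tree's
`Werner2009_halfPlane_twoArm` (mixed pair, `t ∈ [1/2, 1/2 + δ)`) implies the same bound for
`|t - 1/2| < δ`, `n ≤ L(t, ε)` for `t ≠ 1/2` (`real_domArmEvent_mixed_symm`, `charLengthW_symm`). [cite: WernerPCMI2009, Lecture 6, §3 (first paragraph)] [cite: Nolin2008, Thm. 24 (i), §4.6 and Thm. 27 (arXiv 0711.4948: Thm. 23 (i), Thm. 26)] -/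
theorem Werner2009_halfPlane_twoArm.two_sided (h : Werner2009_halfPlane_twoArm) :
    ∃ ε₁ > (0 : ℝ), ∀ ⦃ε : ℝ⦄, 0 < ε → ε < ε₁ →
      ∃ n₀ : ℕ, ∃ δ > (0 : ℝ), ∃ C : ℝ,
        ∀ t : unitInterval, |(t : ℝ) - 1 / 2| < δ →
          ∀ m n : ℕ, n₀ ≤ m → m ≤ n → ((t : ℝ) ≠ 1 / 2 → n ≤ charLengthW ε t) →
            (triSitePercolation t).real (domArmEvent ![true, false] m n upperHalfPlane) ≤
              C * ((m : ℝ) / n) := by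
  obtain ⟨ε₁, hε₁, h⟩ := h
  refine ⟨ε₁, hε₁, fun ε hε hεlt => ?_⟩
  obtain ⟨n₀, δ, hδ, C, hb⟩ := h hε hεlt
  refine ⟨n₀, δ, hδ, C, fun t ht m n hm hmn hnL => ?_⟩
  rw [abs_sub_lt_iff] at ht
  rcases lt_or_ge (t : ℝ) (1 / 2) with hlt | hge
  · obtain ⟨h1, h2⟩ := symm_mem_of_lt_half (δ := δ) hlt (by linarith)
    have hb' := hb (σ t) h1.le h2 m n hm hmn fun _ => by
      rw [charLengthW_symm]; exact hnL hlt.ne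
    rwa [real_domArmEvent_mixed_symm] at hb'
  · exact hb t hge (by linarith) m n hm hmn fun h' => hnL h'.ne'

/-! ### The mixed pair of arms of a pivotal site near the boundary -/

section Mixed

variable {N D : ℕ} {v : Site 2} {ω : SiteConfig (Site 2)}

/-- **An open and a closed arm inside the domain**: if `v` is pivotal for `{0 ↔ ∂Λ_N}`, `|v|_𝕋 ≤ N`,
`2D ≤ |v|_𝕋`, `1 ≤ d₂` and `d₂ + 1 ≤ D`, then `ω - v` has an open and a closed arm from `∂Λ_{d₂}` to
`∂Λ_D`, disjoint, all of whose sites `w` satisfy `|w + v|_𝕋 ≤ N` (`domArmEvent ![T,F] d₂ D`): the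
closed arm is one of the two closed arms of the painted-exterior device
(`shift_mem_domArmEvent_two_closed`); the open arm is cut out of the open path of `ω ∪ {v}` inside
`Λ_N` from the origin to a neighbour of `v` (which exists and avoids `v`, `ω \ {v}` having no arm),
between its last visit to `∂Λ_{d₂}(v)` and its first visit to `∂Λ_D(v)` (`|0 - v|_𝕋 = |v|_𝕋 > D`). Open
and closed sites being distinct, the arms are disjoint. (Werner 2009, Lecture 6, §5, figure: the
pivotal path and the blocking closed paths; Nolin 2008, §6.2, "r₁ provides two black arms, and c₁ two
white arms", here near `∂S_N`.) [cite: WernerPCMI2009, Lecture 6, proof of Lemma 6.2 (boundary contributions) and §5] [cite: Nolin2008, §6.2, proof of Thm. 27, Case 1, and §4.6 (arXiv 0711.4948: Thm. 26)] -/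
theorem shift_mem_domArmEvent_mixed (hD : 1 ≤ D) (hvD : 2 * (D : ℤ) ≤ triNorm v)
    (hvN : triNorm v ≤ N) (hpiv : IsPivotal (triOneArm N) v ω) {d₂ : ℕ} (hd₂ : 1 ≤ d₂)
    (hd₂D : d₂ + 1 ≤ D) :
    SiteConfig.relabel (triShiftIso (-v)).toEquiv ω ∈
      domArmEvent ![true, false] d₂ D {w | triNorm (w + v) ≤ N} := by
  classical
  set φ := triShiftIso (-v) with hφ
  have hφapp : ∀ z, φ z = z - v := fun z => by simp [hφ, sub_eq_add_neg]
  have himage : ∀ (T : Set (Site 2)) (z : Site 2), z ∈ φ '' T ↔ z + v ∈ T := by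
    intro T z
    constructor
    · rintro ⟨z', hz', rfl⟩; rw [hφapp]; simpa using hz'
    · intro hz; exact ⟨z + v, hz, by rw [hφapp]; simp⟩
  have hsymm : ∀ z : Site 2, φ.toEquiv.symm z = z + v := by
    intro z
    apply φ.toEquiv.injective
    rw [Equiv.apply_symm_apply]
    show z = φ (z + v)
    rw [hφapp]; simp
  have hmemω : ∀ z, z ∈ SiteConfig.relabel φ.toEquiv ω ↔ z + v ∈ ω := by
    intro z; rw [SiteConfig.mem_relabel_iff, hsymm]
  -- the closed arm
  obtain ⟨x, y, w, hw, -⟩ :=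
    shift_mem_domArmEvent_two_closed hD hvD hvN hpiv hd₂ (by omega : d₂ ≤ D)
  obtain ⟨hx0, hy0, -, hsupp0, hcol0⟩ := hw 0
  have hclosed : ∀ z ∈ (w 0).support,
      ((d₂ : ℤ) ≤ triNorm z ∧ triNorm z ≤ D) ∧ triNorm (z + v) ≤ N ∧ z + v ∉ ω := by
    intro z hz
    obtain ⟨hz1, hz2⟩ := hsupp0 z hz
    refine ⟨mem_triAnnulus.1 (mem_triAnnulus_of_arm (by omega) hz1), hz2, ?_⟩
    have hc := hcol0 z hz
    have h0 : (![false, false] : Fin 2 → Bool) 0 = false := rfl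
    rw [h0] at hc
    simp only [Bool.false_eq_true, iff_false] at hc
    rwa [hmemω] at hc
  -- the open path of `ω ∪ {v}` from `0` to a neighbour of `v`, avoiding `v`
  have hpiv' := hpiv
  rw [isPivotal_iff_insert_mem_and_notMem (isUpperSet_triOneArm N)] at hpiv'
  obtain ⟨⟨yN, hyN, hconn⟩, hnot⟩ := hpiv'
  set Λ : Set (Site 2) := ↑(triBall N) with hΛ
  have hγ : PathIn triGraph (Λ ∩ insert v ω) 0 yN := PathIn.of_mem_siteConnIn hconn
  have hAsub : (Λ ∩ insert v ω) \ {v} ⊆ Λ ∩ (ω \ {v}) := inter_insert_diff_subset Λ v ω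
  have hv0 : (v : Site 2) ≠ 0 := by
    intro h; rw [h, triNorm_zero] at hvD; omega
  set S : Set (Site 2) := (Λ ∩ insert v ω) \ {v} with hS
  obtain ⟨a₁, ha₁, hpre⟩ : ∃ a₁, triGraph.Adj a₁ v ∧ PathIn triGraph S 0 a₁ := by
    rcases hγ.split_at v with havoid | ⟨hP, -⟩
    · exact (hnot ⟨yN, hyN, (havoid.mono hAsub).mem_siteConnIn⟩).elim
    · exact hP.resolve_left hv0.symm
  have hSmem : ∀ z, z ∈ φ '' S → triNorm (z + v) ≤ N ∧ z + v ∈ ω := by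
    intro z hz
    rw [himage] at hz
    obtain ⟨hzΛ, hzω, hzv⟩ := hAsub hz
    rw [hΛ, Finset.mem_coe, mem_triBall_iff] at hzΛ
    exact ⟨hzΛ, hzω⟩
  -- in the coordinates centred at `v`: from `a₁ - v` (norm `≤ 1`) to `-v` (norm `|v| ≥ 2D`)
  have hp0 : PathIn triGraph (φ '' S) (φ a₁) (φ 0) := (pathIn_map_iso φ hpre).symm
  have ha₁n : triNorm (φ a₁) ≤ 1 := by
    have hadj : triGraph.Adj (φ v) (φ a₁) := (φ.map_adj_iff.2 ha₁).symm
    rw [hφapp v, sub_self] at hadj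
    have := triNorm_le_triNorm_add_one_of_adj hadj
    rw [triNorm_zero] at this
    exact this
  have h0n : triNorm (φ 0) = triNorm v := by rw [hφapp, zero_sub, triNorm_neg]
  -- first visit to norm `≥ D`
  set R₂ : Set (Site 2) := {z | triNorm z < D} with hR₂
  have hxR : φ a₁ ∈ R₂ := by show triNorm (φ a₁) < D; omega
  have hyR : φ 0 ∉ R₂ := by show ¬ triNorm (φ 0) < D; rw [h0n]; omega
  obtain ⟨p, q, hpR, hqR, hqS, hpq, hpath⟩ := hp0.exit hxR hyR
  change triNorm p < D at hpR
  change ¬ triNorm q < D at hqR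
  have hqn : triNorm q = D := by
    have := triNorm_le_triNorm_add_one_of_adj hpq; omega
  have hpath1 : PathIn triGraph (insert q (R₂ ∩ φ '' S)) (φ a₁) q :=
    (hpath.mono fun z hz => mem_insert_of_mem _ hz).tail hpq (mem_insert q _)
  -- last visit to norm `≤ d₂`
  set C : Set (Site 2) := {z | triNorm z ≤ d₂} with hC
  have hxC : φ a₁ ∈ C := by show triNorm (φ a₁) ≤ d₂; omega
  have hqC : q ∉ C := by show ¬ triNorm q ≤ d₂; omega
  obtain ⟨a, b, haC, haS, hbC, hab, hpath2⟩ := hpath1.last_exit hxC hqC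
  change triNorm a ≤ d₂ at haC
  change ¬ triNorm b ≤ d₂ at hbC
  have han : triNorm a = d₂ := by
    have := triNorm_le_triNorm_add_one_of_adj hab; omega
  set T' : Set (Site 2) := insert a (insert q (R₂ ∩ φ '' S) \ C) with hT'
  have hT'path : PathIn triGraph T' a q :=
    (PathIn.of_adj (mem_insert a _) (mem_insert_of_mem _ hpath2.left_mem) hab).trans
      (hpath2.mono fun z hz => mem_insert_of_mem _ hz)
  have hT'sub : ∀ z ∈ T', ((d₂ : ℤ) ≤ triNorm z ∧ triNorm z ≤ D) ∧ z ∈ φ '' S := by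
    intro z hz
    rcases hz with rfl | ⟨hz1, hz2⟩
    · refine ⟨⟨by omega, by omega⟩, ?_⟩
      rcases haS with h | h
      · rw [h]; exact hqS
      · exact h.2
    · change ¬ triNorm z ≤ d₂ at hz2
      rcases hz1 with rfl | ⟨hzR, hzT⟩
      · exact ⟨⟨by omega, by omega⟩, hqS⟩
      · change triNorm z < D at hzR
        exact ⟨⟨by omega, by omega⟩, hzT⟩
  -- the two site sets: open, resp. closed, sites of the annulus inside the domain
  set T₀ : Set (Site 2) := {z | ((d₂ : ℤ) ≤ triNorm z ∧ triNorm z ≤ D) ∧ triNorm (z + v) ≤ N ∧ z + v ∈ ω}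
    with hT₀
  set T₁ : Set (Site 2) := {z | ((d₂ : ℤ) ≤ triNorm z ∧ triNorm z ≤ D) ∧ triNorm (z + v) ≤ N ∧ z + v ∉ ω}
    with hT₁
  have hT'T₀ : T' ⊆ T₀ := fun z hz => ⟨(hT'sub z hz).1, hSmem z (hT'sub z hz).2⟩
  refine mem_domArmEvent_of_pathIn ![true, false] ![T₀, T₁] ?_ ?_ ?_ ?_ ?_
  · -- disjoint
    intro i j hij
    fin_cases i <;> fin_cases j
    · exact absurd rfl hij
    · exact Set.disjoint_left.2 fun z (hz : z ∈ T₀) (hz' : z ∈ T₁) => hz'.2.2 hz.2.2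
    · exact Set.disjoint_left.2 fun z (hz : z ∈ T₁) (hz' : z ∈ T₀) => hz.2.2 hz'.2.2
    · exact absurd rfl hij
  · -- colours
    intro i z hz
    fin_cases i
    · change z ∈ T₀ at hz
      rw [hmemω]; simpa using hz.2.2
    · change z ∈ T₁ at hz
      rw [hmemω]; simpa using hz.2.2
  · -- annulus
    intro i z hz
    fin_cases i
    · exact (show z ∈ T₀ from hz).1
    · exact (show z ∈ T₁ from hz).1
  · -- domain
    intro i z hz
    fin_cases i
    · exact (show z ∈ T₀ from hz).2.1
    · exact (show z ∈ T₁ from hz).2.1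
  · -- the two paths
    intro i
    fin_cases i
    · refine ⟨a, ?_, q, ?_, hT'path.mono hT'T₀⟩
      · rw [mem_triSphere_iff, han]
      · rw [mem_triSphere_iff, hqn]
    · refine ⟨x 0, hx0, y 0, hy0, PathIn.of_walk (w 0) fun z hz => ?_⟩
      exact ⟨(hclosed z hz).1, (hclosed z hz).2.1, (hclosed z hz).2.2⟩

end Mixed

/-! ### The product bounds with the mixed pair -/

section Boundary

variable {N D k d' d₂ m₀ r₀ : ℕ} {v : Site 2}

/-- **Three factors for a pivotal site near the boundary, mixed pair** (Werner 2009, Lecture 6,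
proof of Lemma 6.2, boundary contributions, adapted to the one-arm event, §5; Nolin 2008, §4.6).
For `|v|_𝕋 = k`, `k + d' = N`, `1 ≤ r₀ ≤ d'`, `2d' ≤ k`, `1 ≤ D`, `2D ≤ k`, `m₀ + D + 1 ≤ k`,
`d' + 1 ≤ d₂`, `d₂ + 2d' + 1 ≤ D`:
`P_t(v pivotal for 0 ↔ ∂Λ_N) ≤ P_t(0 ↔ ∂Λ_{m₀}) · π̂_t(r₀, d') · P_t(B_{T,F}(d₂ + d', D - d'))`,
`B_{T,F}(m, n) = domArmEvent ![T,F] m n upperHalfPlane` (the tree's `boundary_pivotal_three_le` with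
the mixed pair `shift_mem_domArmEvent_mixed` in place of the two closed arms; the three events are
determined by the disjoint site sets `Λ_{m₀}`, `v + (Λ_{d'} \ Λ_{r₀-1})`,
`(v + t) + (Λ_{D-d'} \ Λ_{d₂+d'-1})`, and `P_t` is invariant under translations and rotations). [cite: WernerPCMI2009, Lecture 6, proof of Lemma 6.2 (boundary contributions) and §5] [cite: Nolin2008, §4.6] -/
theorem boundary_pivotal_three_le_mixed (t : unitInterval) (hk : triNorm v = k) (hkN : k + d' = N)
    (hr₀ : 1 ≤ r₀) (hr₀d : r₀ ≤ d') (h2d : 2 * d' ≤ k) (hD : 1 ≤ D) (h2D : 2 * D ≤ k)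
    (hm₀ : m₀ + D + 1 ≤ k) (hd₂ : d' + 1 ≤ d₂) (hrec : d₂ + 2 * d' + 1 ≤ D) :
    (triSitePercolation t).real {ω | IsPivotal (triOneArm N) v ω} ≤
      (triSitePercolation t).real (triOneArm m₀) * (fourArmProbAt t r₀ d' *
        (triSitePercolation t).real (domArmEvent ![true, false] (d₂ + d') (D - d') upperHalfPlane)) := by
  classical
  obtain ⟨j, -, tt, htt, hdom⟩ := exists_rot_halfPlane_superset (N := N) hk hkN
  set G : Set (Site 2) := (triRotIsoPow j) '' upperHalfPlane with hG
  set A : Set (SiteConfig (Site 2)) := triOneArm m₀ with hA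
  set B : Set (SiteConfig (Site 2)) :=
    SiteConfig.relabel (triShiftIso (-v)).toEquiv ⁻¹' armEvent ![true, false, true, false] r₀ d' with hB
  set C : Set (SiteConfig (Site 2)) :=
    SiteConfig.relabel (triShiftIso (-(v + tt))).toEquiv ⁻¹'
      domArmEvent ![true, false] (d₂ + d') (D - d') G with hC
  -- the inclusion
  have hincl : {ω : SiteConfig (Site 2) | IsPivotal (triOneArm N) v ω} ⊆ A ∩ (B ∩ C) := by
    intro ω hω
    have hω' : IsPivotal (triOneArm N) v ω := hω
    refine ⟨isPivotal_triOneArm_subset_triOneArm hk (by omega) hω, ?_, ?_⟩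
    · exact armEvent_mono_left _ hr₀ hr₀d
        (shift_mem_armEvent_of_isPivotal_triOneArm' (N := N) (hr₀.trans hr₀d)
          (by rw [hk]; exact_mod_cast h2d) (by rw [hk]; exact_mod_cast hkN.le) hω')
    · have h2 := shift_mem_domArmEvent_mixed (N := N) hD (by rw [hk]; exact_mod_cast h2D)
        (by rw [hk]; exact_mod_cast (show k ≤ N by omega)) hω' (d₂ := d₂) (by omega) (by omega)
      have h3 := shift_mem_domArmEvent_recenter (κ := ![true, false]) (G := G) htt hrec hdom h2
      rw [relabel_shift_shift] at h3
      exact h3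
  -- determining sets
  set F : Finset (Site 2) := triBall m₀ with hF
  set G₁ : Finset (Site 2) := (triAnnulus r₀ d').image fun u => u + v with hG₁
  set G₂ : Finset (Site 2) := (triAnnulus (d₂ + d') (D - d')).image fun u => u + (v + tt) with hG₂
  have hAF : DeterminedBy A ↑F := determinedBy_triOneArm m₀
  have hBG : DeterminedBy B ↑G₁ := determinedBy_preimage_shift (determinedBy_armEvent _ hr₀d) v
  have hCG : DeterminedBy C ↑G₂ :=
    determinedBy_preimage_shift (determinedBy_domArmEvent _ (by omega) G) (v + tt)
  have hG₁mem : ∀ z ∈ G₁, (k : ℤ) - d' ≤ triNorm z ∧ triNorm (z - v) ≤ d' := by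
    intro z hz
    rw [hG₁, Finset.mem_image] at hz
    obtain ⟨u, hu, rfl⟩ := hz
    rw [mem_triAnnulus] at hu
    have h1 := triNorm_add_le (u + v) (-u)
    rw [add_neg_cancel_comm, triNorm_neg] at h1
    refine ⟨by rw [← hk]; omega, by rw [add_sub_cancel_right]; exact hu.2⟩
  have hG₂mem : ∀ z ∈ G₂, (k : ℤ) - D ≤ triNorm z ∧ (d₂ : ℤ) ≤ triNorm (z - v) := by
    intro z hz
    rw [hG₂, Finset.mem_image] at hz
    obtain ⟨u, hu, rfl⟩ := hz
    rw [mem_triAnnulus] at hu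
    push_cast [Nat.cast_sub (show d' ≤ D by omega)] at hu
    have h1 := triNorm_add_le (u + (v + tt)) (-(u + tt))
    rw [show u + (v + tt) + -(u + tt) = v by abel, triNorm_neg] at h1
    have h2 := triNorm_add_le u tt
    have h3 := triNorm_add_le (u + tt) (-tt)
    rw [add_neg_cancel_right, triNorm_neg] at h3
    rw [htt] at h2 h3
    refine ⟨by rw [← hk]; omega, ?_⟩
    rw [show u + (v + tt) - v = u + tt by abel]
    omega
  have hFG₁ : Disjoint F G₁ := by
    rw [Finset.disjoint_left]
    intro z hzF hz
    rw [hF, mem_triBall_iff] at hzF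
    have := (hG₁mem z hz).1; omega
  have hFG₂ : Disjoint F G₂ := by
    rw [Finset.disjoint_left]
    intro z hzF hz
    rw [hF, mem_triBall_iff] at hzF
    have := (hG₂mem z hz).1; omega
  have hG₁G₂ : Disjoint G₁ G₂ := by
    rw [Finset.disjoint_left]
    intro z hz1 hz2
    have := (hG₁mem z hz1).2; have := (hG₂mem z hz2).2; omega
  have hBC : DeterminedBy (B ∩ C) ↑(G₁ ∪ G₂) :=
    (hBG.mono (by rw [Finset.coe_union]; exact Set.subset_union_left)).inter
      (hCG.mono (by rw [Finset.coe_union]; exact Set.subset_union_right))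
  have hFGG : Disjoint F (G₁ ∪ G₂) := Finset.disjoint_union_right.2 ⟨hFG₁, hFG₂⟩
  -- independence, translation and rotation invariance
  have h1 : (triSitePercolation t).real (A ∩ (B ∩ C)) =
      (triSitePercolation t).real A * (triSitePercolation t).real (B ∩ C) :=
    sitePercolation_real_inter_of_disjoint t hAF hBC hFGG
  have h2 : (triSitePercolation t).real (B ∩ C) =
      (triSitePercolation t).real B * (triSitePercolation t).real C :=
    sitePercolation_real_inter_of_disjoint t hBG hCG hG₁G₂
  have h3 : (triSitePercolation t).real B = fourArmProbAt t r₀ d' := by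
    rw [fourArmProbAt, hB, triSitePercolation]
    exact sitePercolation_real_preimage_relabel _ t _
  have h4 : (triSitePercolation t).real C =
      (triSitePercolation t).real (domArmEvent ![true, false] (d₂ + d') (D - d') upperHalfPlane) := by
    rw [hC, triSitePercolation, sitePercolation_real_preimage_relabel, hG]
    exact real_domArmEvent_rotPow t _ _ _ j
  calc (triSitePercolation t).real {ω | IsPivotal (triOneArm N) v ω}
      ≤ (triSitePercolation t).real (A ∩ (B ∩ C)) := measureReal_mono hincl
    _ = (triSitePercolation t).real A * (fourArmProbAt t r₀ d' *
          (triSitePercolation t).real (domArmEvent ![true, false] (d₂ + d') (D - d') upperHalfPlane)) := by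
        rw [h1, h2, h3, h4]

/-- **Two factors for a pivotal site at the boundary, mixed pair** (the local four-arm factor
dropped): for `|v|_𝕋 = k`, `k + d' = N`, `1 ≤ D`, `2D ≤ k`, `m₀ + D + 1 ≤ k`, `1 ≤ d₂`,
`d₂ + 2d' + 1 ≤ D`: `P_t(v pivotal for 0 ↔ ∂Λ_N) ≤ P_t(0 ↔ ∂Λ_{m₀}) · P_t(B_{T,F}(d₂ + d', D - d'))`. [cite: WernerPCMI2009, Lecture 6, proof of Lemma 6.2 (boundary contributions) and §5] -/
theorem boundary_pivotal_two_le_mixed (t : unitInterval) (hk : triNorm v = k) (hkN : k + d' = N)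
    (hD : 1 ≤ D) (h2D : 2 * D ≤ k) (hm₀ : m₀ + D + 1 ≤ k) (hd₂ : 1 ≤ d₂)
    (hrec : d₂ + 2 * d' + 1 ≤ D) :
    (triSitePercolation t).real {ω | IsPivotal (triOneArm N) v ω} ≤
      (triSitePercolation t).real (triOneArm m₀) *
        (triSitePercolation t).real (domArmEvent ![true, false] (d₂ + d') (D - d') upperHalfPlane) := by
  classical
  obtain ⟨j, -, tt, htt, hdom⟩ := exists_rot_halfPlane_superset (N := N) hk hkN
  set G : Set (Site 2) := (triRotIsoPow j) '' upperHalfPlane with hG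
  set A : Set (SiteConfig (Site 2)) := triOneArm m₀ with hA
  set C : Set (SiteConfig (Site 2)) :=
    SiteConfig.relabel (triShiftIso (-(v + tt))).toEquiv ⁻¹'
      domArmEvent ![true, false] (d₂ + d') (D - d') G with hC
  have hincl : {ω : SiteConfig (Site 2) | IsPivotal (triOneArm N) v ω} ⊆ A ∩ C := by
    intro ω hω
    have hω' : IsPivotal (triOneArm N) v ω := hω
    refine ⟨isPivotal_triOneArm_subset_triOneArm hk (by omega) hω, ?_⟩
    have h2 := shift_mem_domArmEvent_mixed (N := N) hD (by rw [hk]; exact_mod_cast h2D)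
      (by rw [hk]; exact_mod_cast (show k ≤ N by omega)) hω' (d₂ := d₂) hd₂ (by omega)
    have h3 := shift_mem_domArmEvent_recenter (κ := ![true, false]) (G := G) htt hrec hdom h2
    rw [relabel_shift_shift] at h3
    exact h3
  set F : Finset (Site 2) := triBall m₀ with hF
  set G₂ : Finset (Site 2) := (triAnnulus (d₂ + d') (D - d')).image fun u => u + (v + tt) with hG₂
  have hAF : DeterminedBy A ↑F := determinedBy_triOneArm m₀
  have hCG : DeterminedBy C ↑G₂ :=
    determinedBy_preimage_shift (determinedBy_domArmEvent _ (by omega) G) (v + tt)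
  have hFG₂ : Disjoint F G₂ := by
    rw [Finset.disjoint_left]
    intro z hzF hz
    rw [hF, mem_triBall_iff] at hzF
    rw [hG₂, Finset.mem_image] at hz
    obtain ⟨u, hu, rfl⟩ := hz
    rw [mem_triAnnulus] at hu
    push_cast [Nat.cast_sub (show d' ≤ D by omega)] at hu
    have h1 := triNorm_add_le (u + (v + tt)) (-(u + tt))
    rw [show u + (v + tt) + -(u + tt) = v by abel, triNorm_neg] at h1
    have h2 := triNorm_add_le u tt
    rw [htt] at h2
    omega
  have h1 : (triSitePercolation t).real (A ∩ C) =
      (triSitePercolation t).real A * (triSitePercolation t).real C :=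
    sitePercolation_real_inter_of_disjoint t hAF hCG hFG₂
  have h4 : (triSitePercolation t).real C =
      (triSitePercolation t).real (domArmEvent ![true, false] (d₂ + d') (D - d') upperHalfPlane) := by
    rw [hC, triSitePercolation, sitePercolation_real_preimage_relabel, hG]
    exact real_domArmEvent_rotPow t _ _ _ j
  calc (triSitePercolation t).real {ω | IsPivotal (triOneArm N) v ω}
      ≤ (triSitePercolation t).real (A ∩ C) := measureReal_mono hincl
    _ = _ := by rw [h1, h4]

end Boundary

end Literature.Probability.Percolation
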